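import Mathlib
import HarnessLib

/-!
# Abel summation against oscillating coefficients with a power bound on the partial sums

Topic `Literature/NumberTheory/LFunctions`. Support file (everything PROVED, no definitions, no
named facts) for the conditional rate of equidistribution of closed horocycles
(`Literature.NumberTheory.LFunctions.horocycleRate_of_quasiRH`, `HorocycleRH.lean`; Zagier 1981 §1,
Sarnak 1981 Thm. 1), elementary route: after unfolding, the horocycle average is a sum of smooth
functions against `μ(m)` and `μ(d)/d`, and the quasi-Riemann hypothesis enters only through power
bounds `‖∑_{k ≤ t} c_k‖ ≤ C t^α` for these coefficients (`M(x) = O(x^{θ+ε})`, tree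
`mertens_isBigO_of_quasiRiemannHypothesis_holds`). This file turns such bounds into bounds for
smooth sums, for a general sequence `c : ℕ → ℂ` with `c 0 = 0` and partial sums
`S(t) = ∑_{k ≤ t} c_k`:

* `norm_sum_mul_le_of_partialSum_le` — `‖∑_{k ≤ m} h(k) c_k‖ ≤ C m^α ‖h(m)‖ + C ∫₁^m t^α ‖h'(t)‖ dt`
  for `h` differentiable on `[1, m]` (Abel summation, Mathlib `sum_mul_eq_sub_integral_mul₀'`).
* `sum_Ioc_div_eq` / `norm_integral_inv_sq_mul_partialSum_le` — Abel summation with `1/t` on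
  `[N, X]` and the bound `C N^{β-1}/(1-β)` for its integral when `‖S(t)‖ ≤ C t^β`, `β < 1`;
  hence the tail bound `norm_sum_Ioc_div_le_of_partialSum_le`:
  `‖∑_{N < k ≤ X} c_k / k‖ ≤ C (2 + 1/(1-β)) N^{β-1}`, and its `tsum` form
  `norm_tsum_div_sub_sum_le_of_partialSum_le`.
* `norm_partialSum_div_le_nat` / `norm_partialSum_div_le` — **harmonic partial sums from plain
  ones**: if `‖S(t)‖ ≤ C t^α` with `α < 1` and `∑_{k ≤ n} c_k/k → 0`, then
  `‖∑_{k ≤ n} c_k/k‖ ≤ C (1 + 1/(1-α)) n^{α-1}` (`n ≥ 1`), and `≤ 2C(1 + 1/(1-α)) t^{α-1}` at real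
  `t ≥ 1` — for `c = μ` this is `∑_{d ≤ x} μ(d)/d = O(x^{θ-1+ε})` under quasi-RH (with the tree's
  `tendsto_sum_moebius_div_zero`), the input of the zero Fourier mode.

## References
* Mathlib `Mathlib/NumberTheory/AbelSummation.lean` (Abel's summation formula).
* G. Tenenbaum, *Introduction to Analytic and Probabilistic Number Theory*, 3rd ed., AMS GSM 163
  (2015), §I.0 (partial summation). Standard; tagged folklore.
-/

noncomputable section

open Real Complex MeasureTheory Set Filter Finset intervalIntegral
open scoped Topology

namespace Literature.NumberTheory.LFunctions

namespace AbelPowerBound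

variable {c : ℕ → ℂ}

/-- A power bound `‖S(1)‖ ≤ C` forces `0 ≤ C`. [folklore] -/
theorem nonneg_of_partialSum_le {C α : ℝ}
    (hS : ∀ t : ℝ, 1 ≤ t → ‖∑ k ∈ Icc 0 ⌊t⌋₊, c k‖ ≤ C * t ^ α) : 0 ≤ C := by
  have := (norm_nonneg _).trans (hS 1 le_rfl)
  simpa using this

/-- **Abel summation with a power bound on the partial sums.** If `c 0 = 0`,
`‖∑_{k ≤ t} c_k‖ ≤ C t^α` for `t ≥ 1`, and `h` is differentiable on `[1, m]` with integrable
derivative (and `t^α ‖h'‖` integrable there), then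
`‖∑_{k ≤ m} h(k) c_k‖ ≤ C m^α ‖h(m)‖ + C ∫₁^m t^α ‖h'(t)‖ dt`. [folklore] -/
theorem norm_sum_mul_le_of_partialSum_le (hc : c 0 = 0) {C α : ℝ}
    (hS : ∀ t : ℝ, 1 ≤ t → ‖∑ k ∈ Icc 0 ⌊t⌋₊, c k‖ ≤ C * t ^ α)
    {h : ℝ → ℂ} {m : ℕ} (hm : 1 ≤ m)
    (hd : ∀ t ∈ Set.Icc (1 : ℝ) m, DifferentiableAt ℝ h t)
    (hi : IntegrableOn (deriv h) (Set.Icc (1 : ℝ) m))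
    (hi' : IntegrableOn (fun t : ℝ => t ^ α * ‖deriv h t‖) (Set.Icc (1 : ℝ) m)) :
    ‖∑ k ∈ Icc 0 m, h k * c k‖ ≤
      C * (m : ℝ) ^ α * ‖h m‖ + C * ∫ t in (1 : ℝ)..m, t ^ α * ‖deriv h t‖ := by
  have hm' : (1 : ℝ) ≤ m := by exact_mod_cast hm
  rw [sum_mul_eq_sub_integral_mul₀' c hc m hd hi]
  have hSm := hS m hm'
  rw [Nat.floor_natCast] at hSm
  refine (norm_sub_le _ _).trans (add_le_add ?_ ?_)
  · rw [norm_mul]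
    calc ‖h m‖ * ‖∑ k ∈ Icc 0 m, c k‖ ≤ ‖h m‖ * (C * (m : ℝ) ^ α) :=
          mul_le_mul_of_nonneg_left hSm (norm_nonneg _)
      _ = C * (m : ℝ) ^ α * ‖h m‖ := by ring
  · rw [← intervalIntegral.integral_of_le hm', ← intervalIntegral.integral_const_mul]
    refine intervalIntegral.norm_integral_le_of_norm_le hm' ?_ ?_
    · refine Eventually.of_forall fun t ht => ?_
      rw [norm_mul]
      calc ‖deriv h t‖ * ‖∑ k ∈ Icc 0 ⌊t⌋₊, c k‖ ≤ ‖deriv h t‖ * (C * t ^ α) :=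
            mul_le_mul_of_nonneg_left (hS t ht.1.le) (norm_nonneg _)
        _ = C * (t ^ α * ‖deriv h t‖) := by ring
    · exact ((intervalIntegrable_iff_integrableOn_Icc_of_le hm').2 hi').const_mul C

/-- `∑_{k ≤ X} g − ∑_{k ≤ N} g = ∑_{N < k ≤ X} g` for `N ≤ X`. [folklore] -/
theorem sum_Icc_sub_sum_Icc (g : ℕ → ℂ) {N X : ℕ} (h : N ≤ X) :
    ∑ k ∈ Icc 0 X, g k - ∑ k ∈ Icc 0 N, g k = ∑ k ∈ Finset.Ioc N X, g k := by
  rw [Finset.Icc_eq_cons_Ioc (Nat.zero_le X), Finset.Icc_eq_cons_Ioc (Nat.zero_le N),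
    Finset.sum_cons, Finset.sum_cons, ← Finset.sum_Ioc_consecutive g (Nat.zero_le N) h]
  ring

/-! ### Abel summation with the weight `1/t` on `[N, X]` -/

/-- `∑_{N < k ≤ X} c_k / k = S(X)/X − S(N)/N + ∫_N^X S(t) t⁻² dt` for `1 ≤ N ≤ X`
(Mathlib `sum_mul_eq_sub_sub_integral_mul` with `f = 1/t`). [folklore] -/
theorem sum_Ioc_div_eq {N X : ℕ} (hN : 1 ≤ N) (hNX : N ≤ X) :
    ∑ k ∈ Finset.Ioc N X, c k / k =
      ((X : ℝ)⁻¹ : ℂ) * (∑ k ∈ Icc 0 X, c k) - ((N : ℝ)⁻¹ : ℂ) * (∑ k ∈ Icc 0 N, c k) +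
        ∫ t in Set.Ioc (N : ℝ) X, (((t ^ 2)⁻¹ : ℝ) : ℂ) * ∑ k ∈ Icc 0 ⌊t⌋₊, c k := by
  have hN' : (1 : ℝ) ≤ N := by exact_mod_cast hN
  have hX' : (N : ℝ) ≤ X := by exact_mod_cast hNX
  set f : ℝ → ℂ := fun t => ((t⁻¹ : ℝ) : ℂ) with hf
  have hD : ∀ t : ℝ, t ≠ 0 → HasDerivAt f ((-(t ^ 2)⁻¹ : ℝ) : ℂ) t := fun t ht0 =>
    (hasDerivAt_inv ht0).ofReal_comp
  have hderiv : ∀ t : ℝ, t ≠ 0 → deriv f t = ((-(t ^ 2)⁻¹ : ℝ) : ℂ) := fun t ht0 =>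
    (hD t ht0).deriv
  have hf_diff : ∀ t ∈ Set.Icc (N : ℝ) X, DifferentiableAt ℝ f t := fun t ht =>
    (hD t (by linarith [ht.1])).differentiableAt
  have hderiv_eq : Set.EqOn (deriv f) (fun t : ℝ => ((-(t ^ 2)⁻¹ : ℝ) : ℂ)) (Set.Icc (N : ℝ) X) :=
    fun t ht => hderiv t (by linarith [ht.1])
  have hcont : ContinuousOn (fun t : ℝ => ((-(t ^ 2)⁻¹ : ℝ) : ℂ)) (Set.Icc (N : ℝ) X) := by
    refine Complex.continuous_ofReal.comp_continuousOn (ContinuousOn.neg ?_)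
    refine ContinuousOn.inv₀ (by fun_prop) fun t ht => ?_
    have : 0 < t := by linarith [ht.1]
    positivity
  have hf_int : IntegrableOn (deriv f) (Set.Icc (N : ℝ) X) :=
    hcont.integrableOn_Icc.congr_fun hderiv_eq.symm measurableSet_Icc
  have habel := sum_mul_eq_sub_sub_integral_mul c (Nat.cast_nonneg N) hX' hf_diff hf_int
  rw [Nat.floor_natCast, Nat.floor_natCast] at habel
  have hsum : ∑ k ∈ Finset.Ioc N X, c k / k = ∑ k ∈ Finset.Ioc N X, f k * c k := by
    refine Finset.sum_congr rfl fun k _ => ?_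
    rw [hf, div_eq_mul_inv, mul_comm]
    push_cast
    rfl
  have hint : ∫ t in Set.Ioc (N : ℝ) X, deriv f t * ∑ k ∈ Icc 0 ⌊t⌋₊, c k =
      -∫ t in Set.Ioc (N : ℝ) X, (((t ^ 2)⁻¹ : ℝ) : ℂ) * ∑ k ∈ Icc 0 ⌊t⌋₊, c k := by
    rw [← MeasureTheory.integral_neg]
    refine setIntegral_congr_fun measurableSet_Ioc fun t ht => ?_
    rw [hderiv t (by linarith [ht.1, hN'])]
    push_cast
    ring
  rw [hsum, habel, hint]
  simp only [hf]
  push_cast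
  ring

/-- The integral of `S(t) t⁻²` over `(N, X]` is `≤ C N^{β-1}/(1-β)` when `‖S(t)‖ ≤ C t^β`,
`β < 1`. [folklore] -/
theorem norm_integral_inv_sq_mul_partialSum_le {C β : ℝ} (hβ : β < 1)
    (hS : ∀ t : ℝ, 1 ≤ t → ‖∑ k ∈ Icc 0 ⌊t⌋₊, c k‖ ≤ C * t ^ β)
    {N X : ℕ} (hN : 1 ≤ N) (hNX : N ≤ X) :
    ‖∫ t in Set.Ioc (N : ℝ) X, (((t ^ 2)⁻¹ : ℝ) : ℂ) * ∑ k ∈ Icc 0 ⌊t⌋₊, c k‖ ≤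
      C / (1 - β) * (N : ℝ) ^ (β - 1) := by
  have hN' : (1 : ℝ) ≤ N := by exact_mod_cast hN
  have hX' : (N : ℝ) ≤ X := by exact_mod_cast hNX
  have hC : 0 ≤ C := nonneg_of_partialSum_le hS
  have hN0 : (0 : ℝ) < N := by linarith
  have hX0 : (0 : ℝ) < X := by linarith
  have hβ' : 0 < 1 - β := by linarith
  have hb : ∀ t ∈ Set.Ioc (N : ℝ) X,
      ‖(((t ^ 2)⁻¹ : ℝ) : ℂ) * ∑ k ∈ Icc 0 ⌊t⌋₊, c k‖ ≤ C * t ^ (β - 2) := by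
    intro t ht
    have ht1 : 1 ≤ t := hN'.trans ht.1.le
    have ht0 : 0 < t := by linarith
    rw [norm_mul, Complex.norm_real, Real.norm_eq_abs, abs_of_pos (by positivity)]
    calc (t ^ 2)⁻¹ * ‖∑ k ∈ Icc 0 ⌊t⌋₊, c k‖ ≤ (t ^ 2)⁻¹ * (C * t ^ β) :=
          mul_le_mul_of_nonneg_left (hS t ht1) (by positivity)
      _ = C * t ^ (β - 2) := by
          rw [Real.rpow_sub ht0, Real.rpow_two]
          field_simp
  have hcont : ContinuousOn (fun t : ℝ => C * t ^ (β - 2)) (Set.Icc (N : ℝ) X) := by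
    refine continuousOn_const.mul (ContinuousOn.rpow_const (by fun_prop) fun t ht => ?_)
    exact Or.inl (by linarith [ht.1] : t ≠ 0)
  have hint : IntegrableOn (fun t : ℝ => C * t ^ (β - 2)) (Set.Ioc (N : ℝ) X) :=
    hcont.integrableOn_Icc.mono_set Set.Ioc_subset_Icc_self
  calc ‖∫ t in Set.Ioc (N : ℝ) X, (((t ^ 2)⁻¹ : ℝ) : ℂ) * ∑ k ∈ Icc 0 ⌊t⌋₊, c k‖
      ≤ ∫ t in Set.Ioc (N : ℝ) X, C * t ^ (β - 2) :=
        norm_integral_le_of_norm_le hint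
          ((ae_restrict_iff' measurableSet_Ioc).2 (Eventually.of_forall hb))
    _ = ∫ t in (N : ℝ)..X, C * t ^ (β - 2) := (intervalIntegral.integral_of_le hX').symm
    _ = C * (((X : ℝ) ^ (β - 1) - (N : ℝ) ^ (β - 1)) / (β - 1)) := by
        rw [intervalIntegral.integral_const_mul, integral_rpow]
        · rw [show β - 2 + 1 = β - 1 by ring]
        · exact Or.inr ⟨by linarith, Set.notMem_uIcc_of_lt hN0 hX0⟩
    _ = C * (((N : ℝ) ^ (β - 1) - (X : ℝ) ^ (β - 1)) / (1 - β)) := by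
        have hβ1 : β - 1 ≠ 0 := (by linarith : β - 1 < 0).ne
        have hβ2 : 1 - β ≠ 0 := hβ'.ne'
        field_simp
        ring
    _ ≤ C * ((N : ℝ) ^ (β - 1) / (1 - β)) := by
        refine mul_le_mul_of_nonneg_left (div_le_div_of_nonneg_right ?_ hβ'.le) hC
        linarith [Real.rpow_nonneg hX0.le (β - 1)]
    _ = C / (1 - β) * (N : ℝ) ^ (β - 1) := by ring

/-- **Tail of `∑ c_k / k`.** If `‖∑_{k ≤ t} c_k‖ ≤ C t^β` for `t ≥ 1` with `β < 1`, then for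
`1 ≤ N ≤ X`, `‖∑_{N < k ≤ X} c_k / k‖ ≤ C (2 + 1/(1-β)) N^{β-1}`. [folklore] -/
theorem norm_sum_Ioc_div_le_of_partialSum_le {C β : ℝ} (hβ : β < 1)
    (hS : ∀ t : ℝ, 1 ≤ t → ‖∑ k ∈ Icc 0 ⌊t⌋₊, c k‖ ≤ C * t ^ β)
    {N X : ℕ} (hN : 1 ≤ N) (hNX : N ≤ X) :
    ‖∑ k ∈ Finset.Ioc N X, c k / k‖ ≤ C * (2 + 1 / (1 - β)) * (N : ℝ) ^ (β - 1) := by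
  have hN' : (1 : ℝ) ≤ N := by exact_mod_cast hN
  have hX' : (N : ℝ) ≤ X := by exact_mod_cast hNX
  have hC : 0 ≤ C := nonneg_of_partialSum_le hS
  have hN0 : (0 : ℝ) < N := by linarith
  have hX0 : (0 : ℝ) < X := by linarith
  rw [sum_Ioc_div_eq hN hNX]
  have hSX := hS X (hN'.trans hX')
  have hSN := hS N hN'
  rw [Nat.floor_natCast] at hSX hSN
  have h1 : ‖((X : ℝ)⁻¹ : ℂ) * ∑ k ∈ Icc 0 X, c k‖ ≤ C * (N : ℝ) ^ (β - 1) := by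
    rw [norm_mul, show ((X : ℝ)⁻¹ : ℂ) = (((X : ℝ)⁻¹ : ℝ) : ℂ) by push_cast; rfl, Complex.norm_real,
      Real.norm_eq_abs, abs_of_pos (inv_pos.2 hX0)]
    calc (X : ℝ)⁻¹ * ‖∑ k ∈ Icc 0 X, c k‖ ≤ (X : ℝ)⁻¹ * (C * (X : ℝ) ^ β) :=
          mul_le_mul_of_nonneg_left hSX (inv_pos.2 hX0).le
      _ = C * (X : ℝ) ^ (β - 1) := by rw [Real.rpow_sub_one hX0.ne']; ring
      _ ≤ C * (N : ℝ) ^ (β - 1) :=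
          mul_le_mul_of_nonneg_left (Real.rpow_le_rpow_of_nonpos hN0 hX' (by linarith)) hC
  have h2 : ‖((N : ℝ)⁻¹ : ℂ) * ∑ k ∈ Icc 0 N, c k‖ ≤ C * (N : ℝ) ^ (β - 1) := by
    rw [norm_mul, show ((N : ℝ)⁻¹ : ℂ) = (((N : ℝ)⁻¹ : ℝ) : ℂ) by push_cast; rfl, Complex.norm_real,
      Real.norm_eq_abs, abs_of_pos (inv_pos.2 hN0)]
    calc (N : ℝ)⁻¹ * ‖∑ k ∈ Icc 0 N, c k‖ ≤ (N : ℝ)⁻¹ * (C * (N : ℝ) ^ β) :=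
          mul_le_mul_of_nonneg_left hSN (inv_pos.2 hN0).le
      _ = C * (N : ℝ) ^ (β - 1) := by rw [Real.rpow_sub_one hN0.ne']; ring
  have h3 := norm_integral_inv_sq_mul_partialSum_le hβ hS hN hNX
  calc _ ≤ ‖((X : ℝ)⁻¹ : ℂ) * ∑ k ∈ Icc 0 X, c k - ((N : ℝ)⁻¹ : ℂ) * ∑ k ∈ Icc 0 N, c k‖ +
        ‖∫ t in Set.Ioc (N : ℝ) X, (((t ^ 2)⁻¹ : ℝ) : ℂ) * ∑ k ∈ Icc 0 ⌊t⌋₊, c k‖ := norm_add_le _ _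
    _ ≤ (C * (N : ℝ) ^ (β - 1) + C * (N : ℝ) ^ (β - 1)) + C / (1 - β) * (N : ℝ) ^ (β - 1) :=
        add_le_add ((norm_sub_le _ _).trans (add_le_add h1 h2)) h3
    _ = C * (2 + 1 / (1 - β)) * (N : ℝ) ^ (β - 1) := by ring

/-- `tsum` form of the tail bound: if moreover `∑ c_k/k` is summable, then for `N ≥ 1`,
`‖∑'_k c_k/k − ∑_{k ≤ N} c_k/k‖ ≤ C (2 + 1/(1-β)) N^{β-1}`. [folklore] -/
theorem norm_tsum_div_sub_sum_le_of_partialSum_le {C β : ℝ} (hβ : β < 1)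
    (hS : ∀ t : ℝ, 1 ≤ t → ‖∑ k ∈ Icc 0 ⌊t⌋₊, c k‖ ≤ C * t ^ β)
    (hsum : Summable fun k : ℕ => c k / k) {N : ℕ} (hN : 1 ≤ N) :
    ‖∑' k : ℕ, c k / k - ∑ k ∈ Icc 0 N, c k / k‖ ≤ C * (2 + 1 / (1 - β)) * (N : ℝ) ^ (β - 1) := by
  have hlim : Tendsto (fun X : ℕ => ∑ k ∈ Icc 0 X, c k / k) atTop (𝓝 (∑' k : ℕ, c k / k)) := by
    have h := hsum.hasSum.tendsto_sum_nat
    have e : (fun X : ℕ => ∑ k ∈ Icc 0 X, c k / k) = (fun n : ℕ => ∑ k ∈ Finset.range n, c k / k) ∘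
        fun X : ℕ => X + 1 := by
      funext X
      simp only [Function.comp_apply]
      congr 1
      ext k
      simp
    rw [e]
    exact h.comp (tendsto_add_atTop_nat 1)
  have hev : ∀ᶠ X : ℕ in atTop, ‖∑ k ∈ Icc 0 X, c k / k - ∑ k ∈ Icc 0 N, c k / k‖ ≤
      C * (2 + 1 / (1 - β)) * (N : ℝ) ^ (β - 1) := by
    filter_upwards [eventually_ge_atTop N] with X hX
    rw [sum_Icc_sub_sum_Icc (fun k => c k / k) hX]
    exact norm_sum_Ioc_div_le_of_partialSum_le hβ hS hN hX
  exact le_of_tendsto ((hlim.sub_const _).norm) hev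

/-- **Harmonic partial sums from plain ones (natural argument).** If `c 0 = 0`? (not needed),
`‖∑_{k ≤ t} c_k‖ ≤ C t^α` for `t ≥ 1` with `α < 1`, and `∑_{k ≤ n} c_k/k → 0`, then
`‖∑_{k ≤ n} c_k/k‖ ≤ C (1 + 1/(1-α)) n^{α-1}` for `n ≥ 1`. [folklore] -/
theorem norm_partialSum_div_le_nat {C α : ℝ} (hα : α < 1)
    (hS : ∀ t : ℝ, 1 ≤ t → ‖∑ k ∈ Icc 0 ⌊t⌋₊, c k‖ ≤ C * t ^ α)
    (hlim : Tendsto (fun n : ℕ => ∑ k ∈ Icc 0 n, c k / k) atTop (𝓝 0)) {n : ℕ} (hn : 1 ≤ n) :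
    ‖∑ k ∈ Icc 0 n, c k / k‖ ≤ C * (1 + 1 / (1 - α)) * (n : ℝ) ^ (α - 1) := by
  have hn' : (1 : ℝ) ≤ n := by exact_mod_cast hn
  have hC : 0 ≤ C := nonneg_of_partialSum_le hS
  have hn0 : (0 : ℝ) < n := by linarith
  set A : ℕ → ℂ := fun X => ∑ k ∈ Icc 0 X, c k / k with hA
  set Sn : ℂ := ∑ k ∈ Icc 0 n, c k with hSn
  -- for every `X ≥ n`: `‖A n − S(n)/n‖ ≤ ‖A X‖ + C X^{α-1} + C n^{α-1}/(1-α)`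
  have key : ∀ X : ℕ, n ≤ X → ‖A n - ((n : ℝ)⁻¹ : ℂ) * Sn‖ ≤
      ‖A X‖ + C * (X : ℝ) ^ (α - 1) + C / (1 - α) * (n : ℝ) ^ (α - 1) := by
    intro X hX
    have hX' : (n : ℝ) ≤ X := by exact_mod_cast hX
    have hX0 : (0 : ℝ) < X := by linarith
    have hdiff : A X - A n = ∑ k ∈ Finset.Ioc n X, c k / k :=
      sum_Icc_sub_sum_Icc (fun k => c k / k) hX
    have habel := sum_Ioc_div_eq (c := c) hn hX
    rw [← hdiff] at habel
    -- `A n − S(n)/n = A X − S(X)/X − ∫`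
    have e : A n - ((n : ℝ)⁻¹ : ℂ) * Sn = A X - ((X : ℝ)⁻¹ : ℂ) * (∑ k ∈ Icc 0 X, c k) -
        ∫ t in Set.Ioc (n : ℝ) X, (((t ^ 2)⁻¹ : ℝ) : ℂ) * ∑ k ∈ Icc 0 ⌊t⌋₊, c k := by
      rw [hSn]
      linear_combination -habel
    rw [e]
    have hSX := hS X (hn'.trans hX')
    rw [Nat.floor_natCast] at hSX
    have h1 : ‖((X : ℝ)⁻¹ : ℂ) * ∑ k ∈ Icc 0 X, c k‖ ≤ C * (X : ℝ) ^ (α - 1) := by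
      rw [norm_mul, show ((X : ℝ)⁻¹ : ℂ) = (((X : ℝ)⁻¹ : ℝ) : ℂ) by push_cast; rfl,
        Complex.norm_real, Real.norm_eq_abs, abs_of_pos (inv_pos.2 hX0)]
      calc (X : ℝ)⁻¹ * ‖∑ k ∈ Icc 0 X, c k‖ ≤ (X : ℝ)⁻¹ * (C * (X : ℝ) ^ α) :=
            mul_le_mul_of_nonneg_left hSX (inv_pos.2 hX0).le
        _ = C * (X : ℝ) ^ (α - 1) := by rw [Real.rpow_sub_one hX0.ne']; ring
    have h3 := norm_integral_inv_sq_mul_partialSum_le hα hS hn hX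
    calc _ ≤ ‖A X - ((X : ℝ)⁻¹ : ℂ) * ∑ k ∈ Icc 0 X, c k‖ +
          ‖∫ t in Set.Ioc (n : ℝ) X, (((t ^ 2)⁻¹ : ℝ) : ℂ) * ∑ k ∈ Icc 0 ⌊t⌋₊, c k‖ :=
          norm_sub_le _ _
      _ ≤ (‖A X‖ + C * (X : ℝ) ^ (α - 1)) + C / (1 - α) * (n : ℝ) ^ (α - 1) :=
          add_le_add ((norm_sub_le _ _).trans (add_le_add le_rfl h1)) h3
      _ = _ := by ring
  -- let `X → ∞`
  have hlim2 : Tendsto (fun X : ℕ => ‖A X‖ + C * (X : ℝ) ^ (α - 1) + C / (1 - α) * (n : ℝ) ^ (α - 1))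
      atTop (𝓝 (0 + 0 + C / (1 - α) * (n : ℝ) ^ (α - 1))) := by
    refine ((tendsto_zero_iff_norm_tendsto_zero.1 hlim).add ?_).add tendsto_const_nhds
    have : Tendsto (fun X : ℕ => (X : ℝ) ^ (α - 1)) atTop (𝓝 0) := by
      have h := tendsto_rpow_neg_atTop (y := 1 - α) (by linarith)
      refine (h.comp tendsto_natCast_atTop_atTop).congr fun X => ?_
      simp [show -(1 - α) = α - 1 by ring]
    simpa using this.const_mul C
  have hle : ‖A n - ((n : ℝ)⁻¹ : ℂ) * Sn‖ ≤ 0 + 0 + C / (1 - α) * (n : ℝ) ^ (α - 1) :=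
    ge_of_tendsto hlim2 (eventually_atTop.2 ⟨n, key⟩)
  have hSn' := hS n hn'
  rw [Nat.floor_natCast] at hSn'
  have h2 : ‖((n : ℝ)⁻¹ : ℂ) * Sn‖ ≤ C * (n : ℝ) ^ (α - 1) := by
    rw [norm_mul, show ((n : ℝ)⁻¹ : ℂ) = (((n : ℝ)⁻¹ : ℝ) : ℂ) by push_cast; rfl,
      Complex.norm_real, Real.norm_eq_abs, abs_of_pos (inv_pos.2 hn0)]
    calc (n : ℝ)⁻¹ * ‖Sn‖ ≤ (n : ℝ)⁻¹ * (C * (n : ℝ) ^ α) :=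
          mul_le_mul_of_nonneg_left hSn' (inv_pos.2 hn0).le
      _ = C * (n : ℝ) ^ (α - 1) := by rw [Real.rpow_sub_one hn0.ne']; ring
  calc ‖A n‖ = ‖(A n - ((n : ℝ)⁻¹ : ℂ) * Sn) + ((n : ℝ)⁻¹ : ℂ) * Sn‖ := by rw [sub_add_cancel]
    _ ≤ ‖A n - ((n : ℝ)⁻¹ : ℂ) * Sn‖ + ‖((n : ℝ)⁻¹ : ℂ) * Sn‖ := norm_add_le _ _
    _ ≤ (0 + 0 + C / (1 - α) * (n : ℝ) ^ (α - 1)) + C * (n : ℝ) ^ (α - 1) := add_le_add hle h2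
    _ = C * (1 + 1 / (1 - α)) * (n : ℝ) ^ (α - 1) := by ring

/-- **Harmonic partial sums from plain ones (real argument).** Under the hypotheses of
`norm_partialSum_div_le_nat` and `0 ≤ α`: `‖∑_{k ≤ t} c_k/k‖ ≤ 2C(1 + 1/(1-α)) t^{α-1}` for all
real `t ≥ 1` (since `⌊t⌋ ≥ t/2`). [folklore] -/
theorem norm_partialSum_div_le {C α : ℝ} (hα0 : 0 ≤ α) (hα : α < 1)
    (hS : ∀ t : ℝ, 1 ≤ t → ‖∑ k ∈ Icc 0 ⌊t⌋₊, c k‖ ≤ C * t ^ α)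
    (hlim : Tendsto (fun n : ℕ => ∑ k ∈ Icc 0 n, c k / k) atTop (𝓝 0)) {t : ℝ} (ht : 1 ≤ t) :
    ‖∑ k ∈ Icc 0 ⌊t⌋₊, c k / k‖ ≤ 2 * C * (1 + 1 / (1 - α)) * t ^ (α - 1) := by
  have hC : 0 ≤ C := nonneg_of_partialSum_le hS
  have hn : 1 ≤ ⌊t⌋₊ := Nat.le_floor (by simpa using ht)
  have h := norm_partialSum_div_le_nat hα hS hlim hn
  refine h.trans ?_
  have ht0 : 0 < t := by linarith
  have hn0 : (0 : ℝ) < ⌊t⌋₊ := by exact_mod_cast hn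
  -- `⌊t⌋ ≥ t/2`, so `⌊t⌋^{α-1} ≤ (t/2)^{α-1} = 2^{1-α} t^{α-1} ≤ 2 t^{α-1}`
  have hfl : t / 2 ≤ ⌊t⌋₊ := by
    have h1 : t < ⌊t⌋₊ + 1 := Nat.lt_floor_add_one t
    have h2 : (1 : ℝ) ≤ ⌊t⌋₊ := by exact_mod_cast hn
    linarith
  have hpow : (⌊t⌋₊ : ℝ) ^ (α - 1) ≤ 2 * t ^ (α - 1) := by
    calc (⌊t⌋₊ : ℝ) ^ (α - 1) ≤ (t / 2) ^ (α - 1) :=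
          Real.rpow_le_rpow_of_nonpos (by positivity) hfl (by linarith)
      _ = 2 ^ (1 - α) * t ^ (α - 1) := by
          rw [Real.div_rpow ht0.le zero_le_two, div_eq_mul_inv, ← Real.rpow_neg zero_le_two,
            show -(α - 1) = 1 - α by ring, mul_comm]
      _ ≤ 2 ^ (1 : ℝ) * t ^ (α - 1) := by
          refine mul_le_mul_of_nonneg_right ?_ (Real.rpow_nonneg ht0.le _)
          exact Real.rpow_le_rpow_of_exponent_le one_le_two (by linarith)
      _ = 2 * t ^ (α - 1) := by rw [Real.rpow_one]
  have hK : 0 ≤ C * (1 + 1 / (1 - α)) := by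
    have : 0 < 1 - α := by linarith
    positivity
  calc C * (1 + 1 / (1 - α)) * (⌊t⌋₊ : ℝ) ^ (α - 1) ≤ C * (1 + 1 / (1 - α)) * (2 * t ^ (α - 1)) :=
        mul_le_mul_of_nonneg_left hpow hK
    _ = 2 * C * (1 + 1 / (1 - α)) * t ^ (α - 1) := by ring

end AbelPowerBound

end Literature.NumberTheory.LFunctions

end
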